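import Mathlib
import HarnessLib
import Literature.Analysis.FluidPDE.TaoAveragedNondegeneracy
import Literature.Topology.Euclidean.PlanarStaircase
import Summits.NavierStokesRegularity.NavierStokesRegularity.Theorems.UnthreadedDoorNetFluxDefs
import Summits.NavierStokesRegularity.NavierStokesRegularity.Theorems.UnthreadedDoorNetFluxOscLeVorticity

/-!
# Route `UnthreadedDoor`, crux `PoloidalLiouville` (stmt-NavierStokesRegularity-1222), WALL W1 — «height-head» tooling:
# A ROUND SPHERE OF `ℝ³` MINUS FINITELY MANY POINTS IS CONNECTED; nonempty relatively open subsets of spheres are infinite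

Tool for K1⁺ `LevelLipschitzOfAnalyticIsolated` (crux idea «height-head», ns-idea-14): the set of REGULAR points of `f|_{S_r(x₀)}`
is connected when the sphere-critical set is finite — this is what lets the analytic value germs be continued along a CHAIN of
charts between any two regular points (`Literature.Topology.IsPreconnected.reflTransGen_of_subset_iUnion`).

* `infinite_sphere_inter_of_mem_nhds` — for `x ∈ S_r(x₀)` (`r > 0`) and `U ∈ 𝓝 x`, `S_r(x₀) ∩ U` is infinite (a great-circle
  arc through `x`); hence `sphere_subset_closure_diff_finite`: `S_r(x₀) ⊆ closure (S_r(x₀) ∖ F)` for finite `F`;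
* `isPreconnected_cap_diff_finite` — an open coordinate hemisphere `{±(x − x₀)₂ > 0}` minus a finite set is preconnected: it is
  the graph image of the open disc of `ℂ` minus finitely many points (tree: `Literature.Topology.Euclidean.isPreconnected_diff_finite`);
  `isPreconnected_cap0_diff_finite` — the same along the axis `0` (coordinate swap isometry);
* **`isPreconnected_sphere_diff_finite`** — `S_r(x₀) ∖ F` is preconnected (`r > 0`, `F` finite): the four hemispheres
  `{±(x−x₀)₂ > 0}`, `{±(x−x₀)₀ > 0}` minus `F` are chained through infinite pairwise intersections
  (`IsPreconnected.iUnion_of_reflTransGen`), cover the sphere up to the finite set `F ∪ {x₀ ± r e₁}`, and a set squeezed between a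
  preconnected set and its closure is preconnected.

WHAT THIS IS NOT: no NS statement; pure topology of round spheres.  `--supports stmt-NavierStokesRegularity-1222 --as helper`.
[folklore]
-/

noncomputable section

-- the summit and its single sub-problem share the name (CONVENTIONS §1)
set_option linter.dupNamespace false

open Set Function Filter Topology InnerProductSpace Metric Relation Complex
open scoped RealInnerProductSpace

namespace Summit.NavierStokesRegularity.NavierStokesRegularity.Theorems.PoloidalLiouville.NetFlux

open Literature.Analysis Literature.Analysis.FluidPDE

/-! ### Great-circle arcs: relatively open subsets of a sphere are infinite -/

/-- **A nonempty relatively open subset of a round sphere in `ℝ³` is infinite**: for `x ∈ S_r(x₀)`, `r > 0`, `U ∈ 𝓝 x`, the set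
`S_r(x₀) ∩ U` contains a great-circle arc through `x`. [folklore] -/
theorem infinite_sphere_inter_of_mem_nhds {x₀ x : E3} {r : ℝ} (hr : 0 < r) (hx : x ∈ Metric.sphere x₀ r) {U : Set E3}
    (hU : U ∈ 𝓝 x) : (Metric.sphere x₀ r ∩ U).Infinite := by
  have hxr : ‖x - x₀‖ = r := mem_sphere_iff_norm.1 hx
  obtain ⟨n, hn1, hna⟩ := exists_unit_orth (x - x₀)
  -- the great circle through `x` with pole `n`
  set γ : ℝ → E3 := fun θ => x₀ + (Real.cos θ • (x - x₀) + Real.sin θ • cross n (x - x₀)) with hγ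
  have hγc : Continuous γ :=
    continuous_const.add ((Real.continuous_cos.smul continuous_const).add (Real.continuous_sin.smul continuous_const))
  have hγ0 : γ 0 = x := by simp [hγ]
  have hac : ⟪x - x₀, cross n (x - x₀)⟫ = 0 := by
    simp only [Tao2016.real_inner_fin3, Tao2016.cross_apply_zero, Tao2016.cross_apply_one, Tao2016.cross_apply_two]; ring
  have hcn : ‖cross n (x - x₀)‖ = r := by rw [norm_cross_of_unit_orth hn1 hna, hxr]
  have hγS : ∀ θ, γ θ ∈ Metric.sphere x₀ r := by
    intro θ
    have hsq : ‖γ θ - x₀‖ ^ 2 = r ^ 2 := by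
      rw [hγ]
      simp only [add_sub_cancel_left]
      rw [← real_inner_self_eq_norm_sq, inner_add_left, inner_add_right, inner_add_right, real_inner_smul_left,
        real_inner_smul_left, real_inner_smul_left, real_inner_smul_left, real_inner_smul_right,
        real_inner_smul_right, real_inner_smul_right, real_inner_smul_right, real_inner_self_eq_norm_sq,
        real_inner_self_eq_norm_sq, hcn, hxr, hac, real_inner_comm (x - x₀) (cross n (x - x₀)), hac]
      linear_combination r ^ 2 * Real.cos_sq_add_sin_sq θ
    rw [mem_sphere_iff_norm]
    nlinarith [norm_nonneg (γ θ - x₀)]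
  -- `⟪γ θ - x₀, x - x₀⟫ = r² cos θ`, so `γ` is injective on `[0, π]`
  have hγinner : ∀ θ, ⟪γ θ - x₀, x - x₀⟫ = r ^ 2 * Real.cos θ := by
    intro θ
    rw [hγ]
    simp only [add_sub_cancel_left]
    rw [inner_add_left, real_inner_smul_left, real_inner_smul_left, real_inner_self_eq_norm_sq, hxr,
      real_inner_comm, hac, mul_zero, add_zero, mul_comm]
  have hγinj : InjOn γ (Icc 0 Real.pi) := by
    intro a ha b hb hab
    have h := congrArg (fun y => ⟪y - x₀, x - x₀⟫) hab
    simp only [hγinner] at h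
    have hcos : Real.cos a = Real.cos b := mul_left_cancel₀ (pow_ne_zero 2 hr.ne') h
    exact Real.injOn_cos ha hb hcos
  -- a small arc inside `U`
  have hpre : γ ⁻¹' U ∈ 𝓝 (0 : ℝ) := hγc.continuousAt.preimage_mem_nhds (by rw [hγ0]; exact hU)
  obtain ⟨δ, hδ, hδU⟩ := Metric.mem_nhds_iff.1 hpre
  set δ' := min δ Real.pi with hδ'
  have hδ'pos : 0 < δ' := lt_min hδ Real.pi_pos
  have hsub : γ '' Ioo 0 δ' ⊆ Metric.sphere x₀ r ∩ U := by
    rintro _ ⟨θ, hθ, rfl⟩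
    refine ⟨hγS θ, hδU ?_⟩
    rw [Metric.mem_ball, Real.dist_eq, sub_zero, abs_of_pos hθ.1]
    exact lt_of_lt_of_le hθ.2 (min_le_left _ _)
  refine Set.Infinite.mono hsub ((Set.Ioo_infinite hδ'pos).image (hγinj.mono fun θ hθ => ?_))
  exact ⟨hθ.1.le, (lt_of_lt_of_le hθ.2 (min_le_right _ _)).le⟩

/-- **The complement of a finite set is dense in the sphere**: `S_r(x₀) ⊆ closure (S_r(x₀) ∖ F)`. [folklore] -/
theorem sphere_subset_closure_diff_finite (x₀ : E3) {r : ℝ} (hr : 0 < r) {F : Set E3} (hF : F.Finite) :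
    Metric.sphere x₀ r ⊆ closure (Metric.sphere x₀ r \ F) := by
  intro x hx
  rw [mem_closure_iff_nhds]
  intro U hU
  obtain ⟨y, ⟨hyS, hyU⟩, hyF⟩ := ((infinite_sphere_inter_of_mem_nhds hr hx hU).sdiff hF).nonempty
  exact ⟨y, hyU, hyS, hyF⟩

/-- A relatively open subset of the sphere containing a point, minus a finite set, is nonempty. [folklore] -/
theorem nonempty_sphere_inter_diff_finite {x₀ x : E3} {r : ℝ} (hr : 0 < r) (hx : x ∈ Metric.sphere x₀ r) {U : Set E3}
    (hU : IsOpen U) (hxU : x ∈ U) {F : Set E3} (hF : F.Finite) : ((Metric.sphere x₀ r ∩ U) \ F).Nonempty :=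
  ((infinite_sphere_inter_of_mem_nhds hr hx (hU.mem_nhds hxU)).sdiff hF).nonempty

/-! ### Coordinate hemispheres minus finite sets -/

/-- **An open coordinate hemisphere `{x ∈ S_r(x₀) : s·(x − x₀)₂ > 0}` (`s = ±1`) minus a finite set is preconnected**: it is the
image of the open disc `|w| < r` of `ℂ` minus finitely many points under the graph map `w ↦ x₀ + (Re w, Im w, s√(r² − |w|²))`.
[folklore] -/
theorem isPreconnected_cap_diff_finite (x₀ : E3) {r : ℝ} (hr : 0 < r) {s : ℝ} (hs : s = 1 ∨ s = -1) {F : Set E3}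
    (hF : F.Finite) : IsPreconnected ({x : E3 | x ∈ Metric.sphere x₀ r ∧ 0 < s * (x - x₀) 2} \ F) := by
  have norm_sq_eq_coord : ∀ y : E3, ‖y‖ ^ 2 = y 0 ^ 2 + y 1 ^ 2 + y 2 ^ 2 := fun y => by
    rw [← real_inner_self_eq_norm_sq, Tao2016.real_inner_fin3]; ring
  have hs2 : s ^ 2 = 1 := by rcases hs with rfl | rfl <;> norm_num
  have hs0 : s ≠ 0 := by rcases hs with rfl | rfl <;> norm_num
  set lift : ℂ → E3 := fun w => x₀ +
    ((w.re) • EuclideanSpace.single (0 : Fin 3) (1 : ℝ) + (w.im) • EuclideanSpace.single (1 : Fin 3) (1 : ℝ)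
      + (s * Real.sqrt (r ^ 2 - ‖w‖ ^ 2)) • EuclideanSpace.single (2 : Fin 3) (1 : ℝ)) with hlift
  have hlift_cont : Continuous lift := by
    refine continuous_const.add ((?_ : Continuous _).add ?_)
    · exact (continuous_re.smul continuous_const).add (continuous_im.smul continuous_const)
    · exact (continuous_const.mul ((continuous_const.sub (continuous_norm.pow 2)).sqrt)).smul continuous_const
  have hl0 : ∀ w : ℂ, (lift w - x₀) 0 = w.re := by intro w; simp [hlift]
  have hl1 : ∀ w : ℂ, (lift w - x₀) 1 = w.im := by intro w; simp [hlift]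
  have hl2 : ∀ w : ℂ, (lift w - x₀) 2 = s * Real.sqrt (r ^ 2 - ‖w‖ ^ 2) := by intro w; simp [hlift]
  have hw2 : ∀ w : ℂ, w.re ^ 2 + w.im ^ 2 = ‖w‖ ^ 2 := fun w => by rw [Complex.sq_norm, Complex.normSq_apply]; ring
  -- `lift` is injective (read off the first two coordinates)
  have hinj : Injective lift := by
    intro a b hab
    apply Complex.ext
    · rw [← hl0 a, ← hl0 b, hab]
    · rw [← hl1 a, ← hl1 b, hab]
  -- `lift` maps the open disc onto the open hemisphere
  have hlift_mem : ∀ w : ℂ, ‖w‖ < r → lift w ∈ Metric.sphere x₀ r ∧ 0 < s * (lift w - x₀) 2 := by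
    intro w hw
    have hpos : 0 < r ^ 2 - ‖w‖ ^ 2 := by nlinarith [norm_nonneg w]
    have hsq : ‖lift w - x₀‖ ^ 2 = r ^ 2 := by
      rw [norm_sq_eq_coord, hl0, hl1, hl2, mul_pow, hs2, one_mul, Real.sq_sqrt hpos.le, hw2]; ring
    refine ⟨?_, ?_⟩
    · rw [mem_sphere_iff_norm]; nlinarith [norm_nonneg (lift w - x₀)]
    · rw [hl2, ← mul_assoc, ← sq, hs2, one_mul]; exact Real.sqrt_pos.2 hpos
  have honto : ∀ x : E3, x ∈ Metric.sphere x₀ r → 0 < s * (x - x₀) 2 → ∃ w : ℂ, ‖w‖ < r ∧ lift w = x := by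
    intro x hx hsx
    set w : ℂ := ((x - x₀) 0 : ℂ) + ((x - x₀) 1 : ℂ) * I with hw
    have hre : w.re = (x - x₀) 0 := by simp [hw]
    have him : w.im = (x - x₀) 1 := by simp [hw]
    have hx2 : (x - x₀) 2 ≠ 0 := fun h0 => by rw [h0, mul_zero] at hsx; exact lt_irrefl _ hsx
    have hwsq : ‖w‖ ^ 2 = r ^ 2 - ((x - x₀) 2) ^ 2 := by
      rw [← hw2, hre, him, ← mem_sphere_iff_norm.1 hx, norm_sq_eq_coord]; ring
    have hwlt : ‖w‖ < r := by
      have : 0 < ((x - x₀) 2) ^ 2 := by positivity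
      nlinarith [norm_nonneg w]
    refine ⟨w, hwlt, ?_⟩
    have h3 : s * Real.sqrt (r ^ 2 - ‖w‖ ^ 2) = (x - x₀) 2 := by
      rw [hwsq, sub_sub_cancel, Real.sqrt_sq_eq_abs]
      rcases hs with rfl | rfl
      · rw [one_mul] at hsx ⊢; exact abs_of_pos hsx
      · have : (x - x₀) 2 < 0 := by linarith
        rw [abs_of_neg this]; ring
    rw [← sub_left_inj (a := x₀)]
    ext i
    fin_cases i
    · exact (hl0 _).trans hre
    · exact (hl1 _).trans him
    · exact (hl2 _).trans h3
  -- the hemisphere minus `F` is the image of the disc minus `lift ⁻¹' F`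
  have hFf : (lift ⁻¹' F).Finite := hF.preimage hinj.injOn
  have hconn : IsPreconnected (Metric.ball (0 : ℂ) r \ lift ⁻¹' F) :=
    Literature.Topology.Euclidean.isPreconnected_diff_finite Metric.isOpen_ball
      (convex_ball (0 : ℂ) r).isPreconnected hFf
  have himage : lift '' (Metric.ball (0 : ℂ) r \ lift ⁻¹' F) =
      {x : E3 | x ∈ Metric.sphere x₀ r ∧ 0 < s * (x - x₀) 2} \ F := by
    ext x
    constructor
    · rintro ⟨w, ⟨hw, hwF⟩, rfl⟩
      exact ⟨hlift_mem w (by simpa using hw), hwF⟩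
    · rintro ⟨⟨hxS, hsx⟩, hxF⟩
      obtain ⟨w, hw, rfl⟩ := honto x hxS hsx
      exact ⟨w, ⟨by simpa using hw, hxF⟩, rfl⟩
  rw [← himage]
  exact hconn.image lift hlift_cont.continuousOn

/-- The same along the axis `0`: `{x ∈ S_r(x₀) : s·(x − x₀)₀ > 0} ∖ F` is preconnected (swap the coordinates `0` and `2`, a
linear isometry of `ℝ³`). [folklore] -/
theorem isPreconnected_cap0_diff_finite (x₀ : E3) {r : ℝ} (hr : 0 < r) {s : ℝ} (hs : s = 1 ∨ s = -1) {F : Set E3}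
    (hF : F.Finite) : IsPreconnected ({x : E3 | x ∈ Metric.sphere x₀ r ∧ 0 < s * (x - x₀) 0} \ F) := by
  set Sw : E3 ≃ₗᵢ[ℝ] E3 := LinearIsometryEquiv.piLpCongrLeft 2 ℝ ℝ (Equiv.swap (0 : Fin 3) 2) with hSw
  have hSw2 : ∀ y : E3, (Sw y) 2 = y 0 := fun y => by
    simp [hSw, LinearIsometryEquiv.piLpCongrLeft_apply, Equiv.swap_apply_right]
  -- the axis-2 hemisphere about `Sw x₀`, minus `Sw '' F`, pulled back by `Sw.symm`
  have h2 := isPreconnected_cap_diff_finite (Sw x₀) hr hs (hF.image Sw)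
  have himage : Sw.symm '' ({x : E3 | x ∈ Metric.sphere (Sw x₀) r ∧ 0 < s * (x - Sw x₀) 2} \ Sw '' F) =
      {x : E3 | x ∈ Metric.sphere x₀ r ∧ 0 < s * (x - x₀) 0} \ F := by
    ext x
    constructor
    · rintro ⟨y, ⟨⟨hyS, hys⟩, hyF⟩, rfl⟩
      refine ⟨⟨?_, ?_⟩, ?_⟩
      · rw [mem_sphere_iff_norm] at hyS ⊢
        rw [← hyS, ← Sw.norm_map (Sw.symm y - x₀), map_sub, LinearIsometryEquiv.apply_symm_apply]
      · rwa [← hSw2, map_sub, LinearIsometryEquiv.apply_symm_apply]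
      · intro hx
        exact hyF ⟨Sw.symm y, hx, LinearIsometryEquiv.apply_symm_apply _ _⟩
    · rintro ⟨⟨hxS, hxs⟩, hxF⟩
      refine ⟨Sw x, ⟨⟨?_, ?_⟩, ?_⟩, Sw.symm_apply_apply x⟩
      · rw [mem_sphere_iff_norm] at hxS ⊢
        rw [← map_sub, Sw.norm_map, hxS]
      · rw [← map_sub, hSw2]; exact hxs
      · rintro ⟨z, hz, hzx⟩
        exact hxF (by rwa [← Sw.injective hzx])
  rw [← himage]
  exact h2.image _ Sw.symm.continuous.continuousOn

/-! ### The sphere minus a finite set -/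

/-- **A round sphere of `ℝ³` minus a finite set is preconnected** (`r > 0`). [folklore] -/
theorem isPreconnected_sphere_diff_finite (x₀ : E3) {r : ℝ} (hr : 0 < r) {F : Set E3} (hF : F.Finite) :
    IsPreconnected (Metric.sphere x₀ r \ F) := by
  have norm_sq_eq_coord : ∀ y : E3, ‖y‖ ^ 2 = y 0 ^ 2 + y 1 ^ 2 + y 2 ^ 2 := fun y => by
    rw [← real_inner_self_eq_norm_sq, Tao2016.real_inner_fin3]; ring
  -- the four coordinate hemispheres, indexed by (axis = 2?, sign = +?)
  set sgn : Bool → ℝ := fun b => if b then 1 else -1 with hsgn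
  have hsgn1 : ∀ b, sgn b = 1 ∨ sgn b = -1 := fun b => by cases b <;> simp [hsgn]
  set H : Bool × Bool → Set E3 := fun p =>
    (if p.1 then {x : E3 | x ∈ Metric.sphere x₀ r ∧ 0 < sgn p.2 * (x - x₀) 2}
      else {x : E3 | x ∈ Metric.sphere x₀ r ∧ 0 < sgn p.2 * (x - x₀) 0}) \ F with hH
  have hHc : ∀ p, IsPreconnected (H p) := by
    rintro ⟨a, b⟩
    cases a
    · simpa [hH] using isPreconnected_cap0_diff_finite x₀ hr (hsgn1 b) hF
    · simpa [hH] using isPreconnected_cap_diff_finite x₀ hr (hsgn1 b) hF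
  -- a point in the intersection of an axis-2 and an axis-0 hemisphere: `x₀ + (r/√2)(s' e₀ + s e₂)`
  have hmeet : ∀ b c : Bool, (H (true, b) ∩ H (false, c)).Nonempty := by
    intro b c
    set q : E3 := x₀ + ((sgn c * (r / Real.sqrt 2)) • EuclideanSpace.single (0 : Fin 3) (1 : ℝ)
      + (sgn b * (r / Real.sqrt 2)) • EuclideanSpace.single (2 : Fin 3) (1 : ℝ)) with hq
    have hq0 : (q - x₀) 0 = sgn c * (r / Real.sqrt 2) := by simp [hq]
    have hq1 : (q - x₀) 1 = 0 := by simp [hq]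
    have hq2 : (q - x₀) 2 = sgn b * (r / Real.sqrt 2) := by simp [hq]
    have hsb : sgn b ^ 2 = 1 := by rcases hsgn1 b with h | h <;> rw [h] <;> norm_num
    have hsc : sgn c ^ 2 = 1 := by rcases hsgn1 c with h | h <;> rw [h] <;> norm_num
    have h22 : Real.sqrt 2 ^ 2 = 2 := Real.sq_sqrt (by norm_num)
    have hqS : q ∈ Metric.sphere x₀ r := by
      have hsq : ‖q - x₀‖ ^ 2 = r ^ 2 := by
        rw [norm_sq_eq_coord, hq0, hq1, hq2]
        field_simp
        nlinarith [hsb, hsc, h22]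
      rw [mem_sphere_iff_norm]; nlinarith [norm_nonneg (q - x₀)]
    have hrs : 0 < r / Real.sqrt 2 := div_pos hr (Real.sqrt_pos.2 (by norm_num))
    have hpos2 : 0 < sgn b * (q - x₀) 2 := by rw [hq2, ← mul_assoc, ← sq, hsb, one_mul]; exact hrs
    have hpos0 : 0 < sgn c * (q - x₀) 0 := by rw [hq0, ← mul_assoc, ← sq, hsc, one_mul]; exact hrs
    -- an open set around `q` inside both hemispheres
    have hc2 : Continuous fun x : E3 => sgn b * (x - x₀) 2 :=
      continuous_const.mul ((EuclideanSpace.proj (2 : Fin 3)).continuous.comp (continuous_id.sub continuous_const))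
    have hc0 : Continuous fun x : E3 => sgn c * (x - x₀) 0 :=
      continuous_const.mul ((EuclideanSpace.proj (0 : Fin 3)).continuous.comp (continuous_id.sub continuous_const))
    have hUo : IsOpen {x : E3 | 0 < sgn b * (x - x₀) 2 ∧ 0 < sgn c * (x - x₀) 0} :=
      (isOpen_lt continuous_const hc2).inter (isOpen_lt continuous_const hc0)
    obtain ⟨y, ⟨hyS, hy2, hy0⟩, hyF⟩ := nonempty_sphere_inter_diff_finite hr hqS hUo ⟨hpos2, hpos0⟩ hF
    exact ⟨y, ⟨⟨hyS, hy2⟩, hyF⟩, ⟨⟨hyS, hy0⟩, hyF⟩⟩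
  have hchain : ∀ p p' : Bool × Bool, ReflTransGen (fun a b => (H a ∩ H b).Nonempty) p p' := by
    rintro ⟨a, b⟩ ⟨a', b'⟩
    cases a <;> cases a'
    · -- both axis 0: through (true, true)
      exact (ReflTransGen.single (by rw [inter_comm]; exact hmeet true b)).tail (hmeet true b')
    · exact ReflTransGen.single (by rw [inter_comm]; exact hmeet b' b)
    · exact ReflTransGen.single (hmeet b b')
    · exact (ReflTransGen.single (hmeet b true)).tail (by rw [inter_comm]; exact hmeet b' true)
  have hT : IsPreconnected (⋃ p, H p) := IsPreconnected.iUnion_of_reflTransGen hHc hchain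
  -- the union covers the sphere up to the finite set `F ∪ {x₀ ± r e₁}`
  set pN : E3 := x₀ + r • EuclideanSpace.single (1 : Fin 3) (1 : ℝ) with hpN
  set pS : E3 := x₀ + (-r) • EuclideanSpace.single (1 : Fin 3) (1 : ℝ) with hpS
  have hsgnt : sgn true = 1 := by simp [hsgn]
  have hsgnf : sgn false = -1 := by simp [hsgn]
  have hcover : Metric.sphere x₀ r \ (F ∪ {pN, pS}) ⊆ ⋃ p, H p := by
    rintro x ⟨hxS, hxF⟩
    simp only [mem_union, mem_insert_iff, mem_singleton_iff, not_or] at hxF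
    obtain ⟨hxF, hxN, hxS'⟩ := hxF
    -- membership in the four pieces
    have m2 : ∀ b : Bool, 0 < sgn b * (x - x₀) 2 → x ∈ ⋃ p, H p := fun b hb =>
      mem_iUnion.2 ⟨(true, b), show x ∈ ({x : E3 | x ∈ Metric.sphere x₀ r ∧ 0 < sgn b * (x - x₀) 2}) \ F from
        ⟨⟨hxS, hb⟩, hxF⟩⟩
    have m0 : ∀ b : Bool, 0 < sgn b * (x - x₀) 0 → x ∈ ⋃ p, H p := fun b hb =>
      mem_iUnion.2 ⟨(false, b), show x ∈ ({x : E3 | x ∈ Metric.sphere x₀ r ∧ 0 < sgn b * (x - x₀) 0}) \ F from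
        ⟨⟨hxS, hb⟩, hxF⟩⟩
    by_cases h2 : (x - x₀) 2 = 0
    · by_cases h0 : (x - x₀) 0 = 0
      · -- then `x = x₀ ± r e₁`
        exfalso
        have hsq : ((x - x₀) 1) ^ 2 = r ^ 2 := by
          rw [← mem_sphere_iff_norm.1 hxS, norm_sq_eq_coord, h0, h2]; ring
        have h1 : (x - x₀) 1 = r ∨ (x - x₀) 1 = -r := sq_eq_sq_iff_eq_or_eq_neg.1 hsq
        have hx : ∀ t : ℝ, (x - x₀) 1 = t → x = x₀ + t • EuclideanSpace.single (1 : Fin 3) (1 : ℝ) := by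
          intro t ht
          rw [← sub_eq_iff_eq_add']
          ext i
          fin_cases i
          · simpa using h0
          · simpa using ht
          · simpa using h2
        rcases h1 with h | h
        · exact hxN (hx r h)
        · exact hxS' (hx (-r) h)
      · rcases lt_or_gt_of_ne h0 with hlt | hgt
        · exact m0 false (by rw [hsgnf]; linarith)
        · exact m0 true (by rw [hsgnt]; linarith)
    · rcases lt_or_gt_of_ne h2 with hlt | hgt
      · exact m2 false (by rw [hsgnf]; linarith)
      · exact m2 true (by rw [hsgnt]; linarith)
  have hTsub : (⋃ p, H p) ⊆ Metric.sphere x₀ r \ F := by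
    intro x hx
    obtain ⟨⟨a, b⟩, hx⟩ := mem_iUnion.1 hx
    cases a
    · exact ⟨hx.1.1, hx.2⟩
    · exact ⟨hx.1.1, hx.2⟩
  -- squeeze between the union and its closure
  refine hT.subset_closure hTsub ?_
  have hfin : (F ∪ {pN, pS}).Finite := hF.union (toFinite _)
  exact fun x hx => closure_mono hcover (sphere_subset_closure_diff_finite x₀ hr hfin hx.1)

end Summit.NavierStokesRegularity.NavierStokesRegularity.Theorems.PoloidalLiouville.NetFlux

end
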